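import Mathlib
import Summits.CriticalPhenomena.PercolationContinuityZ3.Theorems.PercNearOneGluingNoHeavyLowerTailHexMSMatchHybridFree

/-!
# The hybrid-X certificate at the (MATCH*) level (hp-7 gen 80)

Support file for crux `stmt-CriticalPhenomena-4575` (route `PercNearOneGluingNoHeavy`), hull-port seat `prim-hp-7` (generation 80);
`--supports stmt-CriticalPhenomena-4575 --as helper`.  No `sorry`.  Memo: `run/shared/lean/prim/prim-hp-7/FROM-prim-hp-7-g80-TWO-DIRECTIONS.md` §4.

* `Hybrid.card_le_card_farNbhd_of_freePaid` — Hall's condition for the dead set of a depth-one saturated two-class antipodal instance from the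
  hybrid rank on (label `i`) ∪ co(label `i+1`) when the unblocked pairs are PAID: the cross meets `p ∩ q` of dead members of labels `i`, `i+1` that are
  not terms lie in a family `B`, and a family `A` with `#B ≤ #A` of extra small terms is reserved — `A` given explicitly with its four properties
  (terms below members; not within-class differences; never a cross meet; neither `a` nor `U \ a` a member of `𝒟`).  In practice `A` = the free
  admissible cross differences `p \ q ∉ 𝒟` (then `a ⊄ q'` gives 'never a meet').  The remaining side conditions follow from deadness as in
  `…HexMSMatchHybridBridge`.
-/

namespace Summit.CriticalPhenomena.PercolationContinuityZ3.Theorems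

namespace Hybrid

open Finset GeneratedDonors
open scoped FinsetFamily

variable {α : Type*} [DecidableEq α] {U : Finset α}

section DepthOne

variable {𝒟 : Finset (Finset α)} {x : Finset α → ZMod 6}

/-- **(MATCH*) from the hybrid-X certificate** (hp-7 gen 80): as `Hybrid.card_le_card_farNbhd_of_saturated`, but pairs `(p, q)` of dead
members of labels `i`, `i+1` may be unblocked provided their meets lie in `B`, `#B ≤ #A`, for an explicitly given family `A` of extra reserved
small terms (see the file docstring). -/
theorem card_le_card_farNbhd_of_freePaid (A B : Finset (Finset α)) (hU : ∀ a ∈ 𝒟, a ⊆ U) (hco : ∀ a ∈ 𝒟, U \ a ∈ 𝒟)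
    (hanti : ∀ a ∈ 𝒟, x (U \ a) = x a + 3) (i : ZMod 6)
    (hlab : ∀ a ∈ dead U 𝒟 x, x a = i ∨ x a = i + 1 ∨ x a = i + 3 ∨ x a = i + 4)
    (hdepth : ∀ d ∈ 𝒟, d ∉ dead U 𝒟 x →
      (x d = i + 5 ∧ d ∈ scReps U ((dead U 𝒟 x).filter fun a => x a = i) ((dead U 𝒟 x).filter fun a => x a = i + 1)) ∨
      (x d = i + 2 ∧ U \ d ∈ scReps U ((dead U 𝒟 x).filter fun a => x a = i) ((dead U 𝒟 x).filter fun a => x a = i + 1)))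
    (hmeet : ∀ p ∈ dead U 𝒟 x, ∀ q ∈ dead U 𝒟 x, x p = i → x q = i + 1 →
      p \ q ∈ 𝒟 ∨ p ∪ (U \ q) ∈ 𝒟 ∨ p ∩ q ∈ B)
    (hAT : ∀ a ∈ A, a ∈ scTerms ((dead U 𝒟 x).filter fun a => x a = i) ((dead U 𝒟 x).filter fun a => x a = i + 1)
        ((𝒟 \ dead U 𝒟 x).filter fun a => x a = i + 5) ∧ ∃ f ∈ dead U 𝒟 x, (x f = i ∨ x f = i + 1) ∧ a ⊆ f)
    (hApure : ∀ a ∈ A, ∀ f ∈ dead U 𝒟 x, ∀ g ∈ dead U 𝒟 x, x f = x g → (x f = i ∨ x f = i + 1) → a ≠ f \ g)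
    (hAmeet : ∀ a ∈ A, ∀ p ∈ dead U 𝒟 x, ∀ q ∈ dead U 𝒟 x, x p = i → x q = i + 1 → a ≠ p ∩ q)
    (hAD : ∀ a ∈ A, a ∉ 𝒟 ∧ U \ a ∉ 𝒟) (hBA : #B ≤ #A) :
    #𝒟 ≤ #(farNbhd 𝒟 x (dead U 𝒟 x)) := by
  classical
  obtain ⟨n01, n30, n31, n40, n41, n85, n50, n51, n20, n21, n25, n53, n54, e33, e43, e23⟩ := label_facts i
  set P : Finset (Finset α) := (dead U 𝒟 x).filter fun a => x a = i with hPdef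
  set Q : Finset (Finset α) := (dead U 𝒟 x).filter fun a => x a = i + 1 with hQdef
  set W : Finset (Finset α) := (𝒟 \ dead U 𝒟 x).filter fun a => x a = i + 5 with hWdef
  have hP : ∀ p ∈ P, p ∈ dead U 𝒟 x ∧ x p = i := fun p hp => by
    have h := mem_filter.mp hp; exact ⟨h.1, h.2⟩
  have hQ : ∀ q ∈ Q, q ∈ dead U 𝒟 x ∧ x q = i + 1 := fun q hq => by
    have h := mem_filter.mp hq; exact ⟨h.1, h.2⟩
  have hW : ∀ w ∈ W, (w ∈ 𝒟 ∧ w ∉ dead U 𝒟 x) ∧ x w = i + 5 := fun w hw => by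
    have h := mem_filter.mp hw; exact ⟨mem_sdiff.mp h.1, h.2⟩
  have hdD : ∀ {a}, a ∈ dead U 𝒟 x → a ∈ 𝒟 := fun ha => (mem_filter.mp ha).1
  have hcc : ∀ {a}, a ⊆ U → U \ (U \ a) = a := fun ha => Finset.sdiff_sdiff_eq_self ha
  have h1 : ∀ a ∈ P ∪ Q, a ⊆ U := by
    intro a ha
    rcases mem_union.mp ha with ha | ha
    · exact hU a (hdD (hP a ha).1)
    · exact hU a (hdD (hQ a ha).1)
  have hPQlab : ∀ a ∈ P ∪ Q, a ∈ dead U 𝒟 x ∧ (x a = i ∨ x a = i + 1) := by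
    intro a ha
    rcases mem_union.mp ha with ha | ha
    · exact ⟨(hP a ha).1, Or.inl (hP a ha).2⟩
    · exact ⟨(hQ a ha).1, Or.inr (hQ a ha).2⟩
  have hint : ∀ a ∈ P ∪ Q, ∀ b ∈ P ∪ Q, (a ∩ b).Nonempty := fun a ha b hb =>
    inter_nonempty_of_dead_of_close (hPQlab a ha).1 (hdD (hPQlab b hb).1)
      (close_of_mem_pair (hPQlab a ha).2 (hPQlab b hb).2)
  have hcov : ∀ a ∈ P ∪ Q, ∀ b ∈ P ∪ Q, a ∪ b ≠ U := fun a ha b hb =>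
    union_ne_of_dead_of_close hU hco hanti (hPQlab a ha).1 (hdD (hPQlab b hb).1)
      (close_of_mem_pair (hPQlab a ha).2 (hPQlab b hb).2)
  have h4 : W ⊆ scReps U P Q := by
    intro w hw
    obtain ⟨⟨hwD, hwa⟩, hxw⟩ := hW w hw
    rcases hdepth w hwD hwa with ⟨-, h⟩ | ⟨h2', -⟩
    · exact h
    · exact absurd (hxw.symm.trans h2') n25.symm
  have h5 : ∀ a ∈ W, ∀ b ∈ W, a ≠ U \ b := by
    intro a ha b hb hab
    have hxa := (hW a ha).2
    have hxb : x a = x b + 3 := by rw [hab]; exact hanti b (hW b hb).1.1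
    rw [(hW b hb).2] at hxb
    exact n85 (hxb.symm.trans hxa)
  have h6 : ∀ w ∈ W, w ∉ clU U ((P \\ P) ∪ (Q \\ Q)) := by
    intro w hw hmem
    obtain ⟨⟨hwD, -⟩, -⟩ := hW w hw
    have key : ∀ t ∈ (P \\ P) ∪ (Q \\ Q), t ∉ 𝒟 ∧ t ⊆ U := by
      intro t ht
      rcases mem_union.mp ht with ht | ht
      · obtain ⟨a, ha, b, hb, rfl⟩ := mem_diffs.mp ht
        have hda := hP a ha; have hdb := hP b hb
        refine ⟨(sdiff_notMem_of_dead_of_label_eq hU hco hanti (hdD hda.1) (hdD hdb.1) (mem_filter.mp hda.1).2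
          (mem_filter.mp hdb.1).2 (hda.2.trans hdb.2.symm)).2, sdiff_subset.trans (hU a (hdD hda.1))⟩
      · obtain ⟨a, ha, b, hb, rfl⟩ := mem_diffs.mp ht
        have hda := hQ a ha; have hdb := hQ b hb
        refine ⟨(sdiff_notMem_of_dead_of_label_eq hU hco hanti (hdD hda.1) (hdD hdb.1) (mem_filter.mp hda.1).2
          (mem_filter.mp hdb.1).2 (hda.2.trans hdb.2.symm)).2, sdiff_subset.trans (hU a (hdD hda.1))⟩
    rcases mem_clU.mp hmem with h | ⟨t, ht, rfl⟩
    · exact (key w h).1 hwD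
    · have := hco _ hwD
      rw [hcc (key t ht).2] at this
      exact (key t ht).1 this
  -- close labels `i`, `i+5`: no covering pair; far labels `i+1`, `i+5`: no containment
  have hX2W : ∀ p ∈ P, ∀ w ∈ W, p ∪ w ≠ U := by
    intro p hp w hw
    have hcl : Close (x p) (x w) := by
      rw [(hP p hp).2, (hW w hw).2]
      unfold Close
      right; left
      have h6 : (5 : ZMod 6) + 1 = 0 := by decide
      rw [add_assoc, h6, add_zero]
    exact union_ne_of_dead_of_close hU hco hanti (hP p hp).1 (hW w hw).1.1 hcl
  have hX1W : ∀ w ∈ W, ∀ q ∈ Q, ¬ w ⊆ q := by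
    intro w hw q hq
    have hfar : ¬ Close (x w) (x q) := by
      rw [(hW w hw).2, (hQ q hq).2]
      have : ∀ j : ZMod 6, ¬ Close (j + 5) (j + 1) := by decide
      exact this i
    exact not_subset_of_dead_of_not_close hU hco hanti (hQ q hq).1 (hW w hw).1.1 hfar
  have hmeet' : ∀ p ∈ P, ∀ q ∈ Q, p ∩ q ∈ scTerms P Q W ∨ p ∩ q ∈ B := by
    intro p hp q hq
    have hpd := hP p hp; have hqd := hQ q hq
    have hqU : q ⊆ U := hU q (hdD hqd.1)
    -- labels of the two candidate blockers are forced
    rcases hmeet p hpd.1 q hqd.1 hpd.2 hqd.2 with h | h | h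
    rotate_left 2
    · exact Or.inr h
    · left
      suffices hw : p \ q ∈ W by
        have e : p ∩ q = p \ (p \ q) := by
          ext j; simp only [mem_inter, mem_sdiff]; tauto
        rw [e]; unfold scTerms; simp only [mem_union]
        exact Or.inl (Or.inl (Or.inl (Or.inr (mem_diffs.mpr ⟨p, hp, _, hw, rfl⟩))))
      have hlab5 : x (p \ q) = i + 5 := by
        rw [← hpd.2]; exact label_sdiff_of_dead_adjacent hU hco hanti hpd.1 hqd.1 (by rw [hpd.2, hqd.2]) h
      have halive : p \ q ∉ dead U 𝒟 x := by
        intro hdead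
        rcases hlab _ hdead with h' | h' | h' | h'
        · exact n50 (hlab5.symm.trans h')
        · exact n51 (hlab5.symm.trans h')
        · exact n53 (hlab5.symm.trans h')
        · exact n54 (hlab5.symm.trans h')
      exact mem_filter.mpr ⟨mem_sdiff.mpr ⟨h, halive⟩, hlab5⟩
    · left
      suffices hw : p ∪ (U \ q) ∈ W by
        have e : p ∩ q = q ⊓ (p ∪ (U \ q)) := by
          ext j; simp only [inf_eq_inter, mem_inter, mem_union, mem_sdiff]
          constructor
          · rintro ⟨hjp, hjq⟩; exact ⟨hjq, Or.inl hjp⟩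
          · rintro ⟨hjq, h' | h'⟩
            · exact ⟨h', hjq⟩
            · exact absurd hjq h'.2
        rw [e]; unfold scTerms; simp only [mem_union]
        exact Or.inl (Or.inr (mem_infs.mpr ⟨q, hq, _, hw, rfl⟩))
      -- `U \ (p ∪ (U \ q)) = q \ p ∈ 𝒟` has label `x p + 2`, so `p ∪ (U \ q)` has label `x p + 5`
      have hmem' : q \ p ∈ 𝒟 := by
        have e : U \ (p ∪ (U \ q)) = q \ p := by
          ext j; simp only [mem_sdiff, mem_union, not_or, not_and, not_not]
          constructor
          · rintro ⟨hjU, hjp, hj⟩; exact ⟨hj hjU, hjp⟩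
          · rintro ⟨hjq, hjp⟩; exact ⟨hU q (hdD hqd.1) hjq, hjp, fun _ => hjq⟩
        rw [← e]; exact hco _ h
      have hlab2 : x (q \ p) = i + 2 := by
        rw [← hpd.2]; exact label_sdiff_of_dead_adjacent' hU hco hanti hpd.1 hqd.1 (by rw [hpd.2, hqd.2]) hmem'
      have hwU : p ∪ (U \ q) ⊆ U := union_subset (hU p (hdD hpd.1)) sdiff_subset
      have e2 : U \ (q \ p) = p ∪ (U \ q) := by
        have e : U \ (p ∪ (U \ q)) = q \ p := by
          ext j; simp only [mem_sdiff, mem_union, not_or, not_and, not_not]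
          constructor
          · rintro ⟨hjU, hjp, hj⟩; exact ⟨hj hjU, hjp⟩
          · rintro ⟨hjq, hjp⟩; exact ⟨hU q (hdD hqd.1) hjq, hjp, fun _ => hjq⟩
        rw [← e, hcc hwU]
      have hlab5 : x (p ∪ (U \ q)) = i + 5 := by
        rw [← e2, hanti _ hmem', hlab2]; ring
      have halive : p ∪ (U \ q) ∉ dead U 𝒟 x := by
        intro hdead
        rcases hlab _ hdead with h' | h' | h' | h'
        · exact n50 (hlab5.symm.trans h')
        · exact n51 (hlab5.symm.trans h')
        · exact n53 (hlab5.symm.trans h')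
        · exact n54 (hlab5.symm.trans h')
      exact mem_filter.mpr ⟨mem_sdiff.mpr ⟨h, halive⟩, hlab5⟩
  -- the properties of `A` at the block level
  have hAT' : ∀ a ∈ A, a ∈ scTerms P Q W ∧ ∃ f ∈ P ∪ Q, a ⊆ f := by
    intro a ha
    obtain ⟨h1', f, hf, hxf, haf⟩ := hAT a ha
    refine ⟨h1', f, ?_, haf⟩
    rcases hxf with h | h
    · exact mem_union_left _ (mem_filter.mpr ⟨hf, h⟩)
    · exact mem_union_right _ (mem_filter.mpr ⟨hf, h⟩)
  have hApure' : ∀ a ∈ A, a ∉ (P \\ P) ∪ (Q \\ Q) := by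
    intro a ha hmem
    rcases mem_union.mp hmem with h | h
    · obtain ⟨f, hf, g, hg, hfg⟩ := mem_diffs.mp h
      exact hApure a ha f (hP f hf).1 g (hP g hg).1 ((hP f hf).2.trans (hP g hg).2.symm) (Or.inl (hP f hf).2) hfg.symm
    · obtain ⟨f, hf, g, hg, hfg⟩ := mem_diffs.mp h
      exact hApure a ha f (hQ f hf).1 g (hQ g hg).1 ((hQ f hf).2.trans (hQ g hg).2.symm) (Or.inr (hQ f hf).2) hfg.symm
  have hAmeet' : ∀ a ∈ A, ∀ p ∈ P, ∀ q ∈ Q, a ≠ p ∩ q := fun a ha p hp q hq =>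
    hAmeet a ha p (hP p hp).1 q (hQ q hq).1 (hP p hp).2 (hQ q hq).2
  have hAW' : ∀ a ∈ A, a ∉ W ∧ U \ a ∉ W := fun a ha =>
    ⟨fun h => (hAD a ha).1 (hW a h).1.1, fun h => (hAD a ha).2 (hW _ h).1.1⟩
  have hineq : 2 * (#P + #Q + #W) ≤ #(clU U (scTerms P Q W)) :=
    two_mul_card_le_card_clU_scTerms_of_freePaid P Q W A B h1 hint hcov h4 h5 h6 hX1W hX2W hmeet' hAT' hApure' hAmeet' hAW' hBA
  have hsub : clU U (scTerms P Q W) ⊆ farNbhd 𝒟 x (dead U 𝒟 x) :=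
    clU_scTerms_subset_farNbhd hU hco hanti i hP hQ (fun w hw => ⟨(hW w hw).1.1, (hW w hw).2⟩)
  -- counting 𝒟: every member or its complement lies in P ∪ Q ∪ W
  set A : Finset (Finset α) := 𝒟.filter fun d => x d = i ∨ x d = i + 1 ∨ x d = i + 5 with hAdef
  set B : Finset (Finset α) := 𝒟.filter fun d => ¬ (x d = i ∨ x d = i + 1 ∨ x d = i + 5) with hBdef
  have hmemPQW : ∀ d ∈ 𝒟, (x d = i ∨ x d = i + 1 ∨ x d = i + 5) → d ∈ P ∪ Q ∪ W := by
    intro d hd hx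
    simp only [mem_union]
    by_cases hdead : d ∈ dead U 𝒟 x
    · rcases hx with h | h | h
      · exact Or.inl (Or.inl (mem_filter.mpr ⟨hdead, h⟩))
      · exact Or.inl (Or.inr (mem_filter.mpr ⟨hdead, h⟩))
      · exfalso
        rcases hlab d hdead with h' | h' | h' | h'
        · exact n50 (h.symm.trans h')
        · exact n51 (h.symm.trans h')
        · exact n53 (h.symm.trans h')
        · exact n54 (h.symm.trans h')
    · rcases hdepth d hd hdead with ⟨h5', -⟩ | ⟨h2', -⟩
      · exact Or.inr (mem_filter.mpr ⟨mem_sdiff.mpr ⟨hd, hdead⟩, h5'⟩)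
      · exfalso
        rcases hx with h | h | h
        · exact n20 (h2'.symm.trans h)
        · exact n21 (h2'.symm.trans h)
        · exact n25 (h2'.symm.trans h)
  have hA : A ⊆ P ∪ Q ∪ W := fun d hd => hmemPQW d (mem_filter.mp hd).1 (mem_filter.mp hd).2
  have hB : B.image (fun d => U \ d) ⊆ P ∪ Q ∪ W := by
    intro e he
    obtain ⟨d, hd, rfl⟩ := mem_image.mp he
    obtain ⟨hdD', hnot⟩ := mem_filter.mp hd
    refine hmemPQW (U \ d) (hco d hdD') ?_
    rw [hanti d hdD']
    by_cases hdead : d ∈ dead U 𝒟 x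
    · rcases hlab d hdead with h | h | h | h
      · exact absurd (Or.inl h) hnot
      · exact absurd (Or.inr (Or.inl h)) hnot
      · rw [h]; exact Or.inl e33
      · rw [h]; exact Or.inr (Or.inl e43)
    · rcases hdepth d hdD' hdead with ⟨h5', -⟩ | ⟨h2', -⟩
      · exact absurd (Or.inr (Or.inr h5')) hnot
      · rw [h2']; exact Or.inr (Or.inr e23)
  have hinjB : Set.InjOn (fun d : Finset α => U \ d) ↑B := by
    intro d hd e he hde
    have hdU : d ⊆ U := hU d (mem_filter.mp (mem_coe.mp hd)).1
    have heU : e ⊆ U := hU e (mem_filter.mp (mem_coe.mp he)).1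
    have h1' := congrArg (fun t => U \ t) hde
    simp only [hcc hdU, hcc heU] at h1'
    exact h1'
  have hsplit : #A + #B = #𝒟 := card_filter_add_card_filter_not _
  have hcardA : #A ≤ #(P ∪ Q ∪ W) := card_le_card hA
  have hcardB : #B ≤ #(P ∪ Q ∪ W) := by
    rw [← card_image_of_injOn hinjB]; exact card_le_card hB
  have hunion : #(P ∪ Q ∪ W) ≤ #P + #Q + #W :=
    (card_union_le _ _).trans (Nat.add_le_add_right (card_union_le _ _) _)
  have hT := card_le_card hsub
  omega

end DepthOne

end Hybrid

end Summit.CriticalPhenomena.PercolationContinuityZ3.Theorems
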